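import Mathlib
import HarnessLib
import Summits.Ventures.LatticeQCDFlow.Scoring.GlivenkoCantelliRate

/-!
# A finite-sample TWO-SAMPLE band: if two independent codes sample the SAME law, their
# empirical distribution functions after `n` and `m` draws differ uniformly by less than `ε`
# except with probability at most `2(⌈4/ε⌉ + 1)(e^{−nε²/8} + e^{−mε²/8})` — a
# Kolmogorov–Smirnov-type agreement test with explicit constants

HONEST FRAMING: exact (Metropolis-corrected) sampling algorithms for lattice gauge theory;
figures of merit are autocorrelation/cost numbers at stated couplings and volumes; no
continuum-physics claim.

Venture `LatticeQCDFlow` (cell pub-lqcd), topic `Scoring`; FANOUT row 4 (`s0-u1-b`, rung S0-B: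
two independent codes compared; the A-versus-B agreement table).  `Scoring/GlivenkoCantelli`
(`reweightedEDF_AB_agree_ae`) proved that the Kolmogorov distance between the two codes'
printed distribution functions tends to zero almost surely; `Scoring/GlivenkoCantelliRate` gave
the one-sample finite-`n` band.  This file is the two-sample corollary on the product space
`P_A ⊗ P_B`: under the null hypothesis "codes `A` and `B` sample the same law `ρ`" (independent
iid streams `Xᵢ` on `Ω_A` and `Yᵢ` on `Ω_B` with `P_B ∘ Y₀⁻¹ = P_A ∘ X₀⁻¹`), for `ε > 0`,
`n, m ≥ 1`: **`measureReal_exists_twoSample_edf_dev_ge_le`** —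
`(P_A ⊗ P_B)(∃ t, ε ≤ |F̂ₙ^A(t) − F̂ₘ^B(t)|) ≤ 2(⌈4/ε⌉ + 1)(e^{−nε²/8} + e^{−mε²/8})`
(triangle inequality through `F = cdf ρ`, each code within `ε/2` of `F` by the one-sample band;
the supremum events are handled through outer measures and `Measure.prod_prod`, which holds
for arbitrary sets).  NEW WORK of the cell; no definition; nothing cited as a fact (the sharp
two-sample Kolmogorov–Smirnov asymptotics are NOT claimed).

## Content

* `abs_sub_lt_of_abs_sub_lt` — the triangle step;
* **`measureReal_exists_twoSample_edf_dev_ge_le`** — the two-sample band.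

NOT CLAIMED: the reweighted (self-normalised) distribution functions; the Kolmogorov–Smirnov
limit law; dependent streams.
-/

noncomputable section

namespace Summit.Ventures.LatticeQCDFlow.Scoring.GlivenkoCantelli

open MeasureTheory ProbabilityTheory Finset Filter Function
open scoped Topology

section TwoSample

variable {ΩA : Type*} [MeasurableSpace ΩA] {PA : Measure ΩA} [IsProbabilityMeasure PA]
variable {ΩB : Type*} [MeasurableSpace ΩB] {PB : Measure ΩB} [IsProbabilityMeasure PB]
variable {X : ℕ → ΩA → ℝ} {Y : ℕ → ΩB → ℝ}

/-- If `|F − a| < ε/2` and `|F − b| < ε/2` then `|a − b| < ε`. [folklore] -/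
theorem abs_sub_lt_of_abs_sub_lt {F a b ε : ℝ} (ha : |F - a| < ε / 2) (hb : |F - b| < ε / 2) :
    |a - b| < ε := by
  have h := abs_sub_lt_iff.1 ha
  have h' := abs_sub_lt_iff.1 hb
  rw [abs_sub_lt_iff]
  constructor <;> linarith

/-- **THE TWO-SAMPLE FINITE-`n` BAND.**  Independent iid real streams `Xᵢ` on `(Ω_A, P_A)` and
`Yᵢ` on `(Ω_B, P_B)` with the SAME law (`P_B ∘ Y₀⁻¹ = P_A ∘ X₀⁻¹`); empirical distribution
functions `F̂ₙ^A(t) = #{i<n : Xᵢ ≤ t}/n`, `F̂ₘ^B(t) = #{i<m : Yᵢ ≤ t}/m`; `ε > 0`, `n, m ≥ 1`.  Then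
`(P_A ⊗ P_B)(∃ t, ε ≤ |F̂ₙ^A(t) − F̂ₘ^B(t)|) ≤ 2(⌈4/ε⌉ + 1)(e^{−nε²/8} + e^{−mε²/8})`. [ours] -/
theorem measureReal_exists_twoSample_edf_dev_ge_le (hXm : ∀ i, Measurable (X i))
    (hindX : iIndepFun X PA) (hidX : ∀ i, IdentDistrib (X i) (X 0) PA PA)
    (hYm : ∀ i, Measurable (Y i)) (hindY : iIndepFun Y PB)
    (hidY : ∀ i, IdentDistrib (Y i) (Y 0) PB PB) (hlaw : PB.map (Y 0) = PA.map (X 0)) {ε : ℝ}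
    (hε : 0 < ε) {n m : ℕ} (hn : 1 ≤ n) (hm : 1 ≤ m) :
    (PA.prod PB).real {ω : ΩA × ΩB | ∃ t : ℝ,
        ε ≤ |(∑ i ∈ range n, (Set.Iic t).indicator (1 : ℝ → ℝ) (X i ω.1)) / n
          - (∑ i ∈ range m, (Set.Iic t).indicator (1 : ℝ → ℝ) (Y i ω.2)) / m|}
      ≤ 2 * ((⌈4 / ε⌉₊ : ℝ) + 1) * (Real.exp (-(n * ε ^ 2 / 8)) + Real.exp (-(m * ε ^ 2 / 8))) := by
  have hε2 : 0 < ε / 2 := half_pos hε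
  have hA := measureReal_exists_edf_dev_ge_le_of_pos hXm hindX hidX hε2 hn
  have hB := measureReal_exists_edf_dev_ge_le_of_pos hYm hindY hidY hε2 hm
  rw [hlaw] at hB
  have e4 : (2 : ℝ) / (ε / 2) = 4 / ε := by
    field_simp
    ring
  rw [e4] at hA hB
  -- the one-sample deviation events
  set SA : Set ΩA := {ω | ∃ t : ℝ, ε / 2 ≤ |cdf (PA.map (X 0)) t
    - (∑ i ∈ range n, (Set.Iic t).indicator (1 : ℝ → ℝ) (X i ω)) / n|} with hSA
  set SB : Set ΩB := {ω | ∃ t : ℝ, ε / 2 ≤ |cdf (PA.map (X 0)) t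
    - (∑ i ∈ range m, (Set.Iic t).indicator (1 : ℝ → ℝ) (Y i ω)) / m|} with hSB
  have hsub : {ω : ΩA × ΩB | ∃ t : ℝ,
      ε ≤ |(∑ i ∈ range n, (Set.Iic t).indicator (1 : ℝ → ℝ) (X i ω.1)) / n
        - (∑ i ∈ range m, (Set.Iic t).indicator (1 : ℝ → ℝ) (Y i ω.2)) / m|}
      ⊆ SA ×ˢ (Set.univ : Set ΩB) ∪ (Set.univ : Set ΩA) ×ˢ SB := by
    rintro ω ⟨t, ht⟩
    by_contra hgood
    simp only [Set.mem_union, Set.mem_prod, Set.mem_univ, and_true, true_and, not_or, hSA, hSB,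
      Set.mem_setOf_eq, not_exists, not_le] at hgood
    have h1 := hgood.1 t
    have h2 := hgood.2 t
    exact absurd ht (not_le.2 (abs_sub_lt_of_abs_sub_lt h1 h2))
  calc (PA.prod PB).real {ω : ΩA × ΩB | ∃ t : ℝ,
        ε ≤ |(∑ i ∈ range n, (Set.Iic t).indicator (1 : ℝ → ℝ) (X i ω.1)) / n
          - (∑ i ∈ range m, (Set.Iic t).indicator (1 : ℝ → ℝ) (Y i ω.2)) / m|}
      ≤ (PA.prod PB).real (SA ×ˢ (Set.univ : Set ΩB) ∪ (Set.univ : Set ΩA) ×ˢ SB) :=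
        measureReal_mono hsub (measure_ne_top _ _)
    _ ≤ (PA.prod PB).real (SA ×ˢ (Set.univ : Set ΩB))
        + (PA.prod PB).real ((Set.univ : Set ΩA) ×ˢ SB) := measureReal_union_le _ _
    _ = PA.real SA + PB.real SB := by
        simp only [measureReal_def, Measure.prod_prod, measure_univ, mul_one, one_mul]
    _ ≤ 2 * ((⌈4 / ε⌉₊ : ℝ) + 1) * Real.exp (-(n * (ε / 2) ^ 2 / 2))
        + 2 * ((⌈4 / ε⌉₊ : ℝ) + 1) * Real.exp (-(m * (ε / 2) ^ 2 / 2)) := add_le_add hA hB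
    _ = 2 * ((⌈4 / ε⌉₊ : ℝ) + 1)
        * (Real.exp (-(n * ε ^ 2 / 8)) + Real.exp (-(m * ε ^ 2 / 8))) := by
        have en : -((n : ℝ) * (ε / 2) ^ 2 / 2) = -(n * ε ^ 2 / 8) := by ring
        have em : -((m : ℝ) * (ε / 2) ^ 2 / 2) = -(m * ε ^ 2 / 8) := by ring
        rw [en, em]
        ring

end TwoSample

end Summit.Ventures.LatticeQCDFlow.Scoring.GlivenkoCantelli

end
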